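import Mathlib
import Literature.NumberTheory.LFunctions.Zhang2022.Section8FrontEnd82
import Literature.NumberTheory.LFunctions.Zhang2022.TypedSection12B
import HarnessLib

/-!
# Zhang (2022) §8 p. 47: the two applications of Lemma 8.4 inside `S_j(𝐚₁₁,𝐚₂₁)` — EDGES from the
# claim node `Skeleton.Lemma84`

Topic `Literature/NumberTheory/LFunctions/Zhang2022` (Landau–Siegel audit tree; verdict-neutral).
Y. Zhang, *Discrete mean estimates and the Landau–Siegel zero*, arXiv:2211.02515v1 (2022)
[Zhang2022LandauSiegel] — **an unrefereed manuscript under adjudication**; D-0069 campaign, cell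
`siegel-zhang`, DISCHARGE lane, front end of `Skeleton.Ded823 c′` (nodes `Z22:§8.u042`,
`Z22:§8.u043`; tex L2428–L2434, PDF p. 47: "by Lemma 8.3 [sic: the displays are Lemma 8.4's]
with `x = P₁/dr` and `x = P₂/dr` respectively"). Theorem-only. The conclusions are the typed claims
`Section8cStatements.Step8u042 c′` / `Step8u043 c′` (slice L2-t8, p412011); the hypothesis is the
banked CLAIM node `Skeleton.Lemma84 c′` (Lemma 8.4, `SkeletonPartTwo`), which is NOT discharged here.

Content: `ϰ̄₁(drn) = (log P₁)⁻¹ (x/n)^{−β₆} log(x/n)` for `n < x = P₁/dr` ((8.6); `β₆ = 3iα/2` is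
purely imaginary, so `conj (x/n)^{β₆} = (x/n)^{−β₆}` for the positive real base) — Lemma 8.4's
summand at `μ = 6`; Lemma 8.4's range hypothesis `dr < PT⁻²` follows from `dr < P₁/T` since
`P₁T ≤ P`; its `O(𝓛⁻⁶)` divided by `log P₁` is the printed `O(𝓛⁻¹⁵)`. Likewise `ϰ̄₂, P₂, β₇, μ = 7`.

| DAG node | typed claim | theorem | status |
|---|---|---|---|
| `Z22:§8.u042` | `Section8cStatements.Step8u042 c′` | `step8u042_of_lemma84` | EDGE `Skeleton.Lemma84 c′ → ·` |
| `Z22:§8.u043` | `Section8cStatements.Step8u043 c′` | `step8u043_of_lemma84` | EDGE `Skeleton.Lemma84 c′ → ·` |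

WHAT THIS FILE IS NOT: a proof of Lemma 8.4; anything about Theorems 1–2 / Landau–Siegel zeros.

## References

* Y. Zhang, arXiv:2211.02515v1 (2022), §8 p. 47 (tex L2428–L2434), Lemma 8.4, (8.6), (8.8);
  (2.22). [cite: Zhang2022LandauSiegel, §8 p.47]
-/

noncomputable section

open Complex Real ComplexConjugate Finset

namespace Literature.NumberTheory.LFunctions.Zhang2022.Section8FrontEnd84

open Literature.NumberTheory.LFunctions.Zhang2022.Skeleton
open Literature.NumberTheory.LFunctions.Zhang2022.Section8FrontEnd82

/-- For a positive real base, `conj (t^β) = t^{conj β}`. [folklore] -/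
private theorem conj_ofReal_cpow {t : ℝ} (ht : 0 < t) (β : ℂ) :
    conj (((t : ℝ) : ℂ) ^ β) = ((t : ℝ) : ℂ) ^ conj β := by
  have harg : ((t : ℝ) : ℂ).arg ≠ π := by
    rw [Complex.arg_ofReal_of_nonneg ht.le]; exact Real.pi_ne_zero.symm
  have h := Complex.conj_cpow ((t : ℝ) : ℂ) (conj β) harg
  rw [Complex.conj_conj, Complex.conj_ofReal] at h
  exact h.symm

/-- `conj β₇ = −β₇` (`β₇ = 5iα/2`). [cite: Zhang2022LandauSiegel, §2 (2.22) p.10] -/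
theorem conj_beta7 (D : ℕ) : conj (beta7 D) = -beta7 D := by
  simp only [beta7, map_div₀, map_mul, Complex.conj_I, Complex.conj_ofReal, map_ofNat]
  ring

/-! ## `Z22:§8.u042`, `Z22:§8.u043`: the two applications of Lemma 8.4 — EDGES from `Skeleton.Lemma84` -/

/-- `conj ϰ₁(km) = (log P₁)⁻¹ (x/m)^{−β₆} log(x/m)` for `x = P₁/k`, `m < x` ((8.6), `β̄₆ = −β₆`).
[cite: Zhang2022LandauSiegel, §8 (8.6) p.45] -/
theorem conj_vk1_mul_eq {D : ℕ} (hP1 : 1 < Skeleton.P1 D) {k m : ℕ} (hk : 1 ≤ k) (hm : 1 ≤ m)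
    (hmx : ((k * m : ℕ) : ℝ) < Skeleton.P1 D) :
    conj (vk1 D (k * m)) =
      ((Real.log (Skeleton.P1 D / k / m) : ℝ) : ℂ) / (Real.log (Skeleton.P1 D) : ℂ) *
        (((Skeleton.P1 D / k / m : ℝ) : ℂ)) ^ (-beta6 D) := by
  have hk0 : (0 : ℝ) < k := by exact_mod_cast hk
  have hm0 : (0 : ℝ) < m := by exact_mod_cast hm
  have hP0 : 0 < Skeleton.P1 D := by linarith
  have ht : 0 < Skeleton.P1 D / k / m := by positivity
  rw [vk1_mul_eq hP1 hk hm hmx, map_mul, map_div₀, Complex.conj_ofReal, Complex.conj_ofReal,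
    conj_ofReal_cpow ht, Typed.Sec12B.conj_beta6]

/-- `conj ϰ₂(km) = (log P₂)⁻¹ (x/m)^{−β₇} log(x/m)` for `x = P₂/k`, `m < x` ((8.6), `β̄₇ = −β₇`).
[cite: Zhang2022LandauSiegel, §8 (8.6) p.45] -/
theorem conj_vk2_mul_eq {D : ℕ} (hP2 : 1 < Skeleton.P2 D) {k m : ℕ} (hk : 1 ≤ k) (hm : 1 ≤ m)
    (hmx : ((k * m : ℕ) : ℝ) < Skeleton.P2 D) :
    conj (vk2 D (k * m)) =
      ((Real.log (Skeleton.P2 D / k / m) : ℝ) : ℂ) / (Real.log (Skeleton.P2 D) : ℂ) *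
        (((Skeleton.P2 D / k / m : ℝ) : ℂ)) ^ (-beta7 D) := by
  have hk0 : (0 : ℝ) < k := by exact_mod_cast hk
  have hm0 : (0 : ℝ) < m := by exact_mod_cast hm
  have hP0 : 0 < Skeleton.P2 D := by linarith
  have ht : 0 < Skeleton.P2 D / k / m := by positivity
  rw [vk2_mul_eq hP2 hk hm hmx, map_mul, map_div₀, Complex.conj_ofReal, Complex.conj_ofReal,
    conj_ofReal_cpow ht, conj_beta7]

/-- **`Z22:§8.u042` ⇐ Lemma 8.4** (`Skeleton.Lemma84 c′ → Section8cStatements.Step8u042 c′`):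
"by Lemma 8.3 [sic: 8.4] with `x = P₁/dr` …
`Σ_n χ(n)ϰ̄₁(drn)ξ₀ⱼ(n;d,r)/n = (L′(1,χ)Π(d,r)/log P₁)𝓖_{j6}(P₁/dr) + O(𝓛⁻¹⁵)` if `dr < P₁/T`" — from
the banked CLAIM node `Skeleton.Lemma84 c′` (Lemma 8.4, NOT discharged here) at `μ = 6`,
`y = P₁/dr` (`T < y < P`; its range hypothesis `dr < PT⁻²` follows from `dr < P₁/T`, `P₁T ≤ P`)
and (8.6) with `β̄₆ = −β₆`; constant `2C₈₄`. [cite: Zhang2022LandauSiegel, §8 p.47, tex L2429] -/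
theorem step8u042_of_lemma84 {c' : ℝ} (h84 : Lemma84 c') : Section8cStatements.Step8u042 c' := by
  unfold Section8cStatements.Step8u042
  obtain ⟨C, D₀, h⟩ := h84
  refine ⟨2 * C, max D₀ ⌈Real.exp 2⌉₊, fun D _ χ hD hq hp hA j hj d r hd hr hdr => ?_⟩
  have hD₀ : D₀ ≤ D := le_trans (le_max_left _ _) hD
  have hL : 2 ≤ ell D := two_le_ell (le_trans (le_max_right _ _) hD)
  obtain ⟨hlogP1, -, hP1PT, -, hP1T, -, hP1P, -⟩ := params hL
  have hL0 : 0 < ell D := by linarith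
  have hT0 : 0 < bigT D := Real.exp_pos _
  have hdr1 : 1 ≤ d * r := Nat.one_le_iff_ne_zero.mpr (Nat.mul_ne_zero (by omega) (by omega))
  have hdr0 : (0 : ℝ) < ((d * r : ℕ) : ℝ) := by exact_mod_cast hdr1
  set x : ℝ := Skeleton.P1 D / ((d * r : ℕ) : ℝ) with hx
  have hP1x : Skeleton.P1 D = ((d * r : ℕ) : ℝ) * x := by rw [hx]; field_simp
  have hxT : bigT D < x := by
    rw [hx, lt_div_iff₀ hdr0]; rw [lt_div_iff₀ hT0] at hdr; linarith
  have hP1pos : 0 < Skeleton.P1 D := Real.rpow_pos_of_pos (Real.exp_pos _) _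
  have hxle : x ≤ Skeleton.P1 D := div_le_self hP1pos.le (by exact_mod_cast hdr1)
  have hxP : x < bigP D := lt_of_le_of_lt hxle hP1P
  have hT1 : 1 < bigT D := by
    rw [bigT]; exact Real.one_lt_exp_iff.mpr (by positivity)
  have hP1one : 1 < Skeleton.P1 D := lt_of_lt_of_le (lt_trans hT1 hxT) hxle
  have hdrPT : ((d * r : ℕ) : ℝ) < bigP D / bigT D ^ 2 := by
    have : Skeleton.P1 D / bigT D ≤ bigP D / bigT D ^ 2 := by
      rw [div_le_div_iff₀ hT0 (by positivity)]; nlinarith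
    exact lt_of_lt_of_le hdr this
  have key := h D χ hD₀ hq hp hA j hj 6 (by simp) d r hd hr hdrPT x hxT hxP
  have hC0 : 0 ≤ C := by
    have := (norm_nonneg _).trans key
    have h6 : 0 < (ell D ^ 6)⁻¹ := by positivity
    nlinarith
  have hsub : Finset.Ico 1 ⌈x⌉₊ ⊆ Finset.Ico 1 (Nsupp D) := Ico_ceil_subset hP1PT hdr1
  have hsum : (∑ n ∈ Finset.Ico 1 (Nsupp D),
        χ (n : ZMod D) * conj (vk1 D (d * r * n)) * xiZero c' D j n d r / (n : ℂ)) =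
      (1 / (Real.log (Skeleton.P1 D) : ℂ)) *
        ∑ n ∈ Finset.Ico 1 ⌈x⌉₊, χ (n : ZMod D) * xiZero c' D j n d r / (n : ℂ) *
          ((x / n : ℝ) : ℂ) ^ (-betaMu D 6) * (Real.log (x / n) : ℂ) := by
    rw [Finset.mul_sum]
    symm
    apply Finset.sum_subset_zero_on_sdiff hsub
    · intro n hn
      rw [Finset.mem_sdiff, Finset.mem_Ico, Finset.mem_Ico, not_and, not_lt] at hn
      have hxn : x ≤ n := Nat.ceil_le.mp (hn.2 hn.1.1)
      have : Skeleton.P1 D ≤ ((d * r * n : ℕ) : ℝ) := by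
        rw [hP1x]; push_cast
        exact mul_le_mul_of_nonneg_left hxn (by positivity)
      rw [vk1_mul_eq_zero this, map_zero, mul_zero, zero_mul, zero_div]
    · intro n hn
      rw [Finset.mem_Ico] at hn
      have hn1 : 1 ≤ n := hn.1
      have hnx : (n : ℝ) < x := Nat.lt_ceil.mp hn.2
      have hn0 : (0 : ℝ) < n := by exact_mod_cast hn1
      have hdrn : ((d * r * n : ℕ) : ℝ) < Skeleton.P1 D := by
        rw [hP1x]; push_cast
        have := mul_lt_mul_of_pos_left hnx hdr0
        push_cast at this; linarith
      rw [conj_vk1_mul_eq hP1one hdr1 hn1 hdrn]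
      have hb : betaMu D 6 = beta6 D := by simp [betaMu]
      rw [hb, show Skeleton.P1 D / ((d * r : ℕ) : ℝ) / n = x / n by rw [hx]]
      ring
  have hlog0 : 0 < Real.log (Skeleton.P1 D) := by rw [hlogP1]; positivity
  rw [hsum, show (1 / (Real.log (Skeleton.P1 D) : ℂ)) *
        (∑ n ∈ Finset.Ico 1 ⌈x⌉₊, χ (n : ZMod D) * xiZero c' D j n d r / (n : ℂ) *
          ((x / n : ℝ) : ℂ) ^ (-betaMu D 6) * (Real.log (x / n) : ℂ)) -
        deriv χ.LFunction 1 * PiW χ d r / (Real.log (Skeleton.P1 D) : ℂ) * frakgW c' D j 6 x =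
      (1 / (Real.log (Skeleton.P1 D) : ℂ)) *
        ((∑ n ∈ Finset.Ico 1 ⌈x⌉₊, χ (n : ZMod D) * xiZero c' D j n d r / (n : ℂ) *
          ((x / n : ℝ) : ℂ) ^ (-betaMu D 6) * (Real.log (x / n) : ℂ)) -
          deriv χ.LFunction 1 * PiW χ d r * frakgW c' D j 6 x) by ring, norm_mul]
  have hn : ‖(1 / (Real.log (Skeleton.P1 D) : ℂ))‖ = 1 / Real.log (Skeleton.P1 D) := by
    rw [norm_div, norm_one, Complex.norm_real, Real.norm_eq_abs, abs_of_pos hlog0]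
  rw [hn]
  calc 1 / Real.log (Skeleton.P1 D) * ‖(∑ n ∈ Finset.Ico 1 ⌈x⌉₊,
          χ (n : ZMod D) * xiZero c' D j n d r / (n : ℂ) * ((x / n : ℝ) : ℂ) ^ (-betaMu D 6) *
            (Real.log (x / n) : ℂ)) - deriv χ.LFunction 1 * PiW χ d r * frakgW c' D j 6 x‖
      ≤ 1 / Real.log (Skeleton.P1 D) * (C * (ell D ^ 6)⁻¹) :=
        mul_le_mul_of_nonneg_left key (by positivity)
    _ = C / 0.504 * (ell D ^ 15)⁻¹ := by rw [hlogP1]; field_simp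
    _ ≤ 2 * C * (ell D ^ 15)⁻¹ := by
        apply mul_le_mul_of_nonneg_right _ (by positivity)
        rw [div_le_iff₀ (by norm_num)]; nlinarith

/-- **`Z22:§8.u043` ⇐ Lemma 8.4** (`Skeleton.Lemma84 c′ → Section8cStatements.Step8u043 c′`):
"… and `x = P₂/dr` respectively:
`Σ_n χ(n)ϰ̄₂(drn)ξ₀ⱼ(n;d,r)/n = (L′(1,χ)Π(d,r)/log P₂)𝓖_{j7}(P₂/dr) + O(𝓛⁻¹⁵)` if `dr < P₂/T`" — from
`Skeleton.Lemma84 c′` at `μ = 7`, `y = P₂/dr`, and (8.6) with `β̄₇ = −β₇`; constant `4C₈₄`.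
[cite: Zhang2022LandauSiegel, §8 p.47, tex L2433] -/
theorem step8u043_of_lemma84 {c' : ℝ} (h84 : Lemma84 c') : Section8cStatements.Step8u043 c' := by
  unfold Section8cStatements.Step8u043
  obtain ⟨C, D₀, h⟩ := h84
  refine ⟨4 * C, max D₀ ⌈Real.exp 2⌉₊, fun D _ χ hD hq hp hA j hj d r hd hr hdr => ?_⟩
  have hD₀ : D₀ ≤ D := le_trans (le_max_left _ _) hD
  have hL : 2 ≤ ell D := two_le_ell (le_trans (le_max_right _ _) hD)
  obtain ⟨-, hlogP2, -, hP2PT, -, hP2T, -, hP2P⟩ := params hL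
  have hL0 : 0 < ell D := by linarith
  have hT0 : 0 < bigT D := Real.exp_pos _
  have hdr1 : 1 ≤ d * r := Nat.one_le_iff_ne_zero.mpr (Nat.mul_ne_zero (by omega) (by omega))
  have hdr0 : (0 : ℝ) < ((d * r : ℕ) : ℝ) := by exact_mod_cast hdr1
  set x : ℝ := Skeleton.P2 D / ((d * r : ℕ) : ℝ) with hx
  have hP2x : Skeleton.P2 D = ((d * r : ℕ) : ℝ) * x := by rw [hx]; field_simp
  have hxT : bigT D < x := by
    rw [hx, lt_div_iff₀ hdr0]; rw [lt_div_iff₀ hT0] at hdr; linarith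
  have hP2pos : 0 < Skeleton.P2 D :=
    div_pos (Real.rpow_pos_of_pos (Real.exp_pos _) _) (pow_pos (Real.exp_pos _) _)
  have hxle : x ≤ Skeleton.P2 D := div_le_self hP2pos.le (by exact_mod_cast hdr1)
  have hxP : x < bigP D := lt_of_le_of_lt hxle hP2P
  have hT1 : 1 < bigT D := by
    rw [bigT]; exact Real.one_lt_exp_iff.mpr (by positivity)
  have hP2one : 1 < Skeleton.P2 D := lt_of_lt_of_le (lt_trans hT1 hxT) hxle
  have hdrPT : ((d * r : ℕ) : ℝ) < bigP D / bigT D ^ 2 := by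
    have : Skeleton.P2 D / bigT D ≤ bigP D / bigT D ^ 2 := by
      rw [div_le_div_iff₀ hT0 (by positivity)]; nlinarith
    exact lt_of_lt_of_le hdr this
  have key := h D χ hD₀ hq hp hA j hj 7 (by simp) d r hd hr hdrPT x hxT hxP
  have hC0 : 0 ≤ C := by
    have := (norm_nonneg _).trans key
    have h6 : 0 < (ell D ^ 6)⁻¹ := by positivity
    nlinarith
  have hsub : Finset.Ico 1 ⌈x⌉₊ ⊆ Finset.Ico 1 (Nsupp D) := Ico_ceil_subset hP2PT hdr1
  have hsum : (∑ n ∈ Finset.Ico 1 (Nsupp D),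
        χ (n : ZMod D) * conj (vk2 D (d * r * n)) * xiZero c' D j n d r / (n : ℂ)) =
      (1 / (Real.log (Skeleton.P2 D) : ℂ)) *
        ∑ n ∈ Finset.Ico 1 ⌈x⌉₊, χ (n : ZMod D) * xiZero c' D j n d r / (n : ℂ) *
          ((x / n : ℝ) : ℂ) ^ (-betaMu D 7) * (Real.log (x / n) : ℂ) := by
    rw [Finset.mul_sum]
    symm
    apply Finset.sum_subset_zero_on_sdiff hsub
    · intro n hn
      rw [Finset.mem_sdiff, Finset.mem_Ico, Finset.mem_Ico, not_and, not_lt] at hn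
      have hxn : x ≤ n := Nat.ceil_le.mp (hn.2 hn.1.1)
      have : Skeleton.P2 D ≤ ((d * r * n : ℕ) : ℝ) := by
        rw [hP2x]; push_cast
        exact mul_le_mul_of_nonneg_left hxn (by positivity)
      rw [vk2_mul_eq_zero this, map_zero, mul_zero, zero_mul, zero_div]
    · intro n hn
      rw [Finset.mem_Ico] at hn
      have hn1 : 1 ≤ n := hn.1
      have hnx : (n : ℝ) < x := Nat.lt_ceil.mp hn.2
      have hn0 : (0 : ℝ) < n := by exact_mod_cast hn1
      have hdrn : ((d * r * n : ℕ) : ℝ) < Skeleton.P2 D := by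
        rw [hP2x]; push_cast
        have := mul_lt_mul_of_pos_left hnx hdr0
        push_cast at this; linarith
      rw [conj_vk2_mul_eq hP2one hdr1 hn1 hdrn]
      have hb : betaMu D 7 = beta7 D := by simp [betaMu]
      rw [hb, show Skeleton.P2 D / ((d * r : ℕ) : ℝ) / n = x / n by rw [hx]]
      ring
  have hlog0 : 0 < Real.log (Skeleton.P2 D) := lt_of_lt_of_le (by positivity) hlogP2
  rw [hsum, show (1 / (Real.log (Skeleton.P2 D) : ℂ)) *
        (∑ n ∈ Finset.Ico 1 ⌈x⌉₊, χ (n : ZMod D) * xiZero c' D j n d r / (n : ℂ) *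
          ((x / n : ℝ) : ℂ) ^ (-betaMu D 7) * (Real.log (x / n) : ℂ)) -
        deriv χ.LFunction 1 * PiW χ d r / (Real.log (Skeleton.P2 D) : ℂ) * frakgW c' D j 7 x =
      (1 / (Real.log (Skeleton.P2 D) : ℂ)) *
        ((∑ n ∈ Finset.Ico 1 ⌈x⌉₊, χ (n : ZMod D) * xiZero c' D j n d r / (n : ℂ) *
          ((x / n : ℝ) : ℂ) ^ (-betaMu D 7) * (Real.log (x / n) : ℂ)) -
          deriv χ.LFunction 1 * PiW χ d r * frakgW c' D j 7 x) by ring, norm_mul]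
  have hn : ‖(1 / (Real.log (Skeleton.P2 D) : ℂ))‖ = 1 / Real.log (Skeleton.P2 D) := by
    rw [norm_div, norm_one, Complex.norm_real, Real.norm_eq_abs, abs_of_pos hlog0]
  rw [hn]
  have hL9 : 0 < ell D ^ 9 := by positivity
  have hinv : 1 / Real.log (Skeleton.P2 D) ≤ 4 / ell D ^ 9 := by
    rw [div_le_div_iff₀ hlog0 hL9]; linarith
  calc 1 / Real.log (Skeleton.P2 D) * ‖(∑ n ∈ Finset.Ico 1 ⌈x⌉₊,
          χ (n : ZMod D) * xiZero c' D j n d r / (n : ℂ) * ((x / n : ℝ) : ℂ) ^ (-betaMu D 7) *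
            (Real.log (x / n) : ℂ)) - deriv χ.LFunction 1 * PiW χ d r * frakgW c' D j 7 x‖
      ≤ 4 / ell D ^ 9 * (C * (ell D ^ 6)⁻¹) :=
        mul_le_mul hinv key (norm_nonneg _) (by positivity)
    _ = 4 * C * (ell D ^ 15)⁻¹ := by field_simp

end Literature.NumberTheory.LFunctions.Zhang2022.Section8FrontEnd84
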